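import Literature.NumberTheory.Automorphic.HeckeLatticeCount
import Literature.LinearAlgebra.Subspace.MoebiusCount
import HarnessLib

/-!
# Tamagawa's rationality theorem for the Hecke series of `GL_n` (Shimura, Thm. 3.21)

Topic `NumberTheory/Automorphic`. Two definitions (`glIntDet`, `heckeDetOperator`) and theorems;
everything stated is proved. Setting: a field `F` with a valuation (`ValuativeRel F`) whose
residue field `𝓀 = 𝓀[F]` is finite with `q = Nat.card 𝓀` elements, a uniformizing element `ϖ`
(`IsUniformizingElement`, `HeckeTransversalGL`), `K = GL_n(𝒪) = glInt n F`, the Hecke operators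
`T_i = [K t_i K]`, `t_i = diag(ϖ 1_i, 1_{n-i})` (`heckeOperator` of `HeckeAlgebra` at
`heckeDiag`; `heckeT` of `SatakeParametersGL` for complex representations) acting on the
`K`-fixed vectors of a representation `ρ` of `GL_n(F)` over a commutative ring `k`.

## Definitions

* `glIntDet n ϖ m = Δ_m = {y ∈ GL_n(F) : y integral, |det y| = |ϖ|^m}` — Shimura's
  `{α ∈ Δ : det α = p^m}` (up to units);
* `heckeDetOperator ρ ϖ m = T(ϖ^m) = ∑_{yK ⊆ Δ_m} ρ(y)`, the sum over the left cosets of `Δ_m`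
  (representatives by `Quotient.out`, as for `heckeOperator`), i.e. the sum of the double-coset
  operators `[K t K]` over the `K`-double cosets in `Δ_m` — the `m`-th coefficient of the formal
  Hecke series `∑_m T(ϖ^m) X^m` (Shimura (1971), §3.2, before Thm. 3.21).

## Main statements (all proved)

* `finite_cosets_glIntDet`: `Δ_m K / K` is finite — by induction on `m` through the
  factorisation `Δ_{m+1} K ⊆ (K t_1 K)(Δ_m K)` (`exists_mem_orbit_smul_eq`: the residue of
  `w ∈ Δ_{m+1}` is singular, so a hyperplane contains its column space, so by the lattice count of
  `HeckeLatticeCount` some `y K ⊆ K t_1 K` has `y⁻¹ w` integral); `ncard_cosets_glIntDet_le`: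
  `#(Δ_m K/K) ≤ #(K t_1 K/K)^m`.
* `heckeDetOperator_apply_mem_fixedPoints`, `heckeDetOperator_zero_apply` (`T(ϖ^0) = 1` on
  `V^K`), `exists_heckeDetOperator_apply_eq_smul` (`T(ϖ^m) = ∑_{KtK ⊆ Δ_m} [KtK]` acts by a scalar
  on `v` as soon as every `[KgK]`, `g ∈ Δ_m`, does — the spherical situation), `heckeOperator_heckeDetOperator_apply` (**product formula**
  `[KxK](T(ϖ^m) v) = ∑_γ #{α ∈ KxK/K : α⁻¹γ ∈ Δ_m K/K} • ρ(γ) v`, as in `HeckeGelfandTrick`).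
* `ncard_orbit_heckeDiag_smul_out_mem` (**Shimura's Lemma 3.22**): for `γ = wK`, `w ∈ Δ_{i+m}`,
  the structure constant `#{α ∈ K t_i K/K : α⁻¹ γ ∈ Δ_m K/K}` is the number of subspaces
  `Y ≤ 𝓀ⁿ` of dimension `n - i` containing the column space of `w mod ϖ`; it vanishes off
  `Δ_{i+m} K` (`…_eq_zero`) and for `i > m` (`card_submodule_ge_cols_eq_zero`).
* `sum_heckeOperator_heckeDetOperator_eq_zero` (**Tamagawa's identity, Shimura Thm. 3.21, operator
  form**): for `v ∈ V^K` and `m ≥ 1`,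
  `∑_{i=0}^{min(m,n)} (-1)^i q^{i(i-1)/2} T_i (T(ϖ^{m-i}) v) = 0`,
  i.e. `(∑_{i ≤ n} (-1)^i q^{i(i-1)/2} T_i X^i)(∑_m T(ϖ^m) X^m) = 1` coefficientwise. The proof
  is Shimura's: by the product formula and Lemma 3.22 the coefficient of `ρ(w) v`, `w ∈ Δ_m`, is
  `∑_i (-1)^i q^{i(i-1)/2} #{Y ⊇ C(w̄) : dim Y = n - i}`, which vanishes by **Lemma 3.23**
  (`Literature.LinearAlgebra.Subspace.sum_neg_one_pow_mul_pow_choose_mul_card_ge_codim_eq_zero`,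
  the Möbius function of the subspace lattice) because `C(w̄) ≠ 𝓀ⁿ`. Also `sum_heckeT_…` for
  complex representations.
* Eigenvalue forms: `sum_heckeEigenvalue_mul_heckeDetEigenvalue_eq_zero` (the linear recursion for
  the eigenvalues `τ_i` of `T_i` and `r_m` of `T(ϖ^m)` on a common non-zero eigenvector in `V^K`),
  `mk_heckeDetEigenvalue_mul_heckePolynomial_eq_one`
  (`(∑ r_m X^m)(∑ (-1)^i q^{i(i-1)/2} τ_i X^i) = 1` in `k⟦X⟧`), and the **Satake form**
  `mk_heckeDetEigenvalue_mul_eulerFactor_eq_one`: if `τ_i = q^{i(n-i)/2} e_i(α)` (`#α = n`, the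
  normalisation of `IsSatakeParameter`) then `(∑ r_m X^m) ∏_{a ∈ α} (1 - q^{(n-1)/2} a X) = 1` —
  the algebraic content of the unramified computation `Z(1_{M_n(𝒪)}, s + (n-1)/2, ω°) = L(s, π)`
  (Godement–Jacquet (1972), Lemma 6.10; Jacquet (1979), (1.4)), for which it was written
  (decomposition of `Literature.NumberTheory.Automorphic.godementJacquet_hasMeromorphicContinuation`).

## Design notes

* No topology or local-field structure on `F` is used: only `ValuativeRel F`, `[Finite 𝓀[F]]` and a
  uniformizing element; for a non-archimedean local field `residueFieldCard F = Nat.card 𝓀[F]`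
  definitionally and every uniformizer is uniformizing, so the statements apply verbatim to
  `IsSatakeParameter` (`SatakeParametersGL`) and to the level-`GL_n(𝒪_v)` Hecke operators of the
  global theory.
* As for `heckeOperator`, the operators are sums of `ρ(γ.out)` over finite sets of cosets
  `γ ∈ G ⧸ K`; all statements are on `K`-fixed vectors, where the choice of representatives is
  immaterial. `glIntDet` and `heckeDetOperator` make sense for any `ϖ`; the theorems assume
  `IsUniformizingElement ϖ`. For `n = 0`, `Δ_m = ∅` for `m ≥ 1` and the identity is trivial.
* The main theorem is over an arbitrary commutative ring `k` (the coefficients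
  `(-1)^i q^{i(i-1)/2}` are integers); the eigenvalue corollaries assume a field (to cancel the
  non-zero eigenvector), the Satake form `k = ℂ` (square roots of `q`).
* Nothing here is in Mathlib (no Hecke operators of `p`-adic groups; `lean search` for
  `heckeSeries`/`HeckeSeries` and `Hecke.*ational` finds nothing, `Tamagawa` only the tree's local
  Tamagawa numbers of elliptic curves); the abstract double-coset framework
  (`heckeOperator`, `heckePairCount`, product formula) is the tree's `HeckeAlgebra` /
  `HeckeGelfandTrick`, reused rather than redefined.

## References

* G. Shimura, *Introduction to the arithmetic theory of automorphic functions*, Publ. Math. Soc.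
  Japan 11 (1971), §3.2: Prop. 3.18, Lemma 3.19, Thm. 3.20, Thm. 3.21 with Lemmas 3.22–3.23,
  (3.2.3), Remark 3.25 (read: 1973 printing held in the literature store,
  `book:shimura1973-introduction-arithmetic-theory-automorphic-functions`, PDF pp. 78–83)
  [ShimuraIATAF1971].
* T. Tamagawa, *On the ζ-functions of a division algebra*, Ann. of Math. 77 (1963), 387–405
  (the result for arbitrary `n`, as attributed by Shimura, p. 82 of the PDF) [TamagawaAnnals1963].
* R. Godement, H. Jacquet, *Zeta functions of simple algebras*, LNM 260 (1972), Lemma 6.10; H.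
  Jacquet, *Principal L-functions of the linear group*, Corvallis (1979), (1.4) (the consumer:
  the unramified local zeta integral) [GodementJacquet1972] [JacquetCorvallis1979].
-/

noncomputable section

open scoped Pointwise
open MulAction ValuativeRel Matrix Finset Literature.LinearAlgebra.Matrix.Echelon
  Literature.NumberTheory.Automorphic.Echelon

namespace Literature.NumberTheory.Automorphic

variable {F : Type*} [Field F] [ValuativeRel F] {n : ℕ}

/-! ### The sets `Δ_m`, their cosets, and the operators `T(ϖ^m)` -/

section Defs

variable (n)

/-- The set `Δ_m(ϖ) = {y ∈ GL_n(F) : y integral, |det y| = |ϖ|^m}` of integral matrices whose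
determinant has valuation `m` (`ϖ` a uniformizer): the union of the double cosets
`K diag(ϖ^{a_1}, …, ϖ^{a_n}) K`, `a_i ≥ 0`, `∑ a_i = m`, `K = GL_n(𝒪)` — Shimura's
`{α ∈ Δ : det α = p^m}` up to units (Shimura (1971), §3.2, the definition of `T(p^m)` before
Thm. 3.21; Tamagawa (1963)). [cite: ShimuraIATAF1971, Theorem 3.21] -/
def glIntDet (ϖ : F) (m : ℕ) : Set (GL (Fin n) F) :=
  {y | IsIntegralMatrix (y : Matrix (Fin n) (Fin n) F) ∧
    valuation F (y : Matrix (Fin n) (Fin n) F).det = valuation F ϖ ^ m}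

variable {n}

/-- Membership in `Δ_m`. [folklore] -/
theorem mem_glIntDet_iff {ϖ : F} {m : ℕ} {y : GL (Fin n) F} :
    y ∈ glIntDet n ϖ m ↔ IsIntegralMatrix (y : Matrix (Fin n) (Fin n) F) ∧
      valuation F (y : Matrix (Fin n) (Fin n) F).det = valuation F ϖ ^ m :=
  Iff.rfl

variable {k V : Type*} [CommRing k] [AddCommGroup V] [Module k V]
  (ρ : Representation k (GL (Fin n) F) V)

/-- **The Hecke operator `T(ϖ^m)`** of `GL_n` relative to `K = GL_n(𝒪)` acting on a
representation `ρ`: the sum `∑_{y K ⊆ Δ_m} ρ(y)` over the left cosets `y K` of integral matrices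
with `|det y| = |ϖ|^m`, i.e. the sum of the double-coset operators `[K t K]` (`heckeOperator`)
over the `K`-double cosets in `Δ_m` — Shimura's `T(p^m)`, the `m`-th coefficient of the formal
Hecke series `∑_m T(p^m) X^m` of Thm. 3.21 (Shimura (1971), §3.2; Tamagawa (1963); Andrianov,
*Quadratic forms and Hecke operators*, Ch. 3). As for `heckeOperator`, representatives are chosen
by `Quotient.out`; on `K`-fixed vectors the value does not depend on this choice
(`heckeDetOperator_apply_eq_sum`) and lies in `V^K` (`heckeDetOperator_apply_mem_fixedPoints`);
`T(ϖ^0) = 1` on `V^K` (`heckeDetOperator_zero_apply`). [cite: ShimuraIATAF1971, Theorem 3.21] -/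
def heckeDetOperator (ϖ : F) (m : ℕ) : Module.End k V :=
  ∑ᶠ γ ∈ {γ : GL (Fin n) F ⧸ glInt n F | γ.out ∈ glIntDet n ϖ m}, ρ γ.out

end Defs

/-! ### Cosets of `Δ_m` and finiteness -/

section Cosets

variable {ϖ : F}

/-- `t_r ∈ Δ_r` for `r ≤ n`. [folklore] -/
theorem heckeDiag_mem_glIntDet (hϖ : IsUniformizingElement ϖ) {r : ℕ} (hr : r ≤ n) :
    heckeDiag n (Units.mk0 ϖ hϖ.ne_zero) r ∈ glIntDet n ϖ r :=
  ⟨isIntegralMatrix_heckeDiag (by exact hϖ.mem) r, valuation_det_heckeDiag _ hr⟩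

/-- `Δ_m` is stable under `K` on the left. [folklore] -/
theorem glInt_mul_mem_glIntDet_iff {κ : GL (Fin n) F} (hκ : κ ∈ glInt n F) {y : GL (Fin n) F}
    {m : ℕ} : κ * y ∈ glIntDet n ϖ m ↔ y ∈ glIntDet n ϖ m :=
  glInt_mul_mem_delta_iff hκ y m

/-- `Δ_m` is stable under `K` on the right. [folklore] -/
theorem mul_glInt_mem_glIntDet_iff {κ : GL (Fin n) F} (hκ : κ ∈ glInt n F) {y : GL (Fin n) F}
    {m : ℕ} : y * κ ∈ glIntDet n ϖ m ↔ y ∈ glIntDet n ϖ m :=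
  mul_glInt_mem_delta_iff hκ y m

/-- The chosen representative of `y K` lies in `Δ_m` iff `y` does. [folklore] -/
theorem mk_out_mem_glIntDet_iff (y : GL (Fin n) F) {m : ℕ} :
    ((y : GL (Fin n) F ⧸ glInt n F).out) ∈ glIntDet n ϖ m ↔ y ∈ glIntDet n ϖ m := by
  obtain ⟨κ, hκ⟩ := QuotientGroup.mk_out_eq_mul (glInt n F) y
  rw [hκ, mul_glInt_mem_glIntDet_iff κ.2]

/-- The set of cosets `Δ_m K / K ⊆ G ⧸ K` is stable under `K`. [folklore] -/
theorem smul_out_mem_glIntDet_iff (κ : glInt n F) (γ : GL (Fin n) F ⧸ glInt n F) {m : ℕ} :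
    (κ • γ).out ∈ glIntDet n ϖ m ↔ γ.out ∈ glIntDet n ϖ m := by
  conv_lhs => rw [← QuotientGroup.out_eq' γ]
  rw [subgroup_smul_mk, mk_out_mem_glIntDet_iff, glInt_mul_mem_glIntDet_iff κ.2]

/-- `a⁻¹ • (a • γ)`-bookkeeping: the representative of `a • γ` lies in `Δ_m` iff `a γ.out` does.
[folklore] -/
theorem smul_out_mem_glIntDet_iff' (a : GL (Fin n) F) (γ : GL (Fin n) F ⧸ glInt n F) {m : ℕ} :
    (a • γ).out ∈ glIntDet n ϖ m ↔ a * γ.out ∈ glIntDet n ϖ m := by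
  conv_lhs => rw [← QuotientGroup.out_eq' γ, MulAction.Quotient.smul_mk, smul_eq_mul]
  exact mk_out_mem_glIntDet_iff _

/-- `Δ_0 K / K` is the single coset `K`. [folklore] -/
theorem out_mem_glIntDet_zero_iff (γ : GL (Fin n) F ⧸ glInt n F) :
    γ.out ∈ glIntDet n ϖ 0 ↔ γ = ((1 : GL (Fin n) F) : GL (Fin n) F ⧸ glInt n F) := by
  rw [glIntDet, Set.mem_setOf_eq, mem_delta_zero_iff]
  conv_rhs => rw [← QuotientGroup.out_eq' γ, QuotientGroup.eq, mul_one]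
  exact (Subgroup.inv_mem_iff _).symm

/-- Representatives of the cosets in `K t_r K / K` lie in `Δ_r`. [folklore] -/
theorem out_mem_glIntDet_of_mem_orbit (hϖ : IsUniformizingElement ϖ) {r : ℕ} (hr : r ≤ n)
    {α : GL (Fin n) F ⧸ glInt n F}
    (hα : α ∈ MulAction.orbit (glInt n F)
      ((heckeDiag n (Units.mk0 ϖ hϖ.ne_zero) r : GL (Fin n) F) : GL (Fin n) F ⧸ glInt n F)) :
    α.out ∈ glIntDet n ϖ r :=
  out_mem_delta_of_mem_orbit hϖ hr hα

/-- For `n = 0` and `m ≥ 1`, `Δ_m` is empty (`det = 1`). [folklore] -/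
theorem glIntDet_eq_empty_of_eq_zero (hϖ : IsUniformizingElement ϖ) (hn : n = 0) {m : ℕ}
    (hm : 1 ≤ m) : glIntDet n ϖ m = ∅ := by
  subst hn
  ext y
  simp only [glIntDet, Set.mem_setOf_eq, Set.mem_empty_iff_false, iff_false, not_and]
  intro _
  rw [Matrix.det_isEmpty, map_one]
  exact (pow_lt_one₀ zero_le hϖ.valuation_lt_one (by omega)).ne'

/-- A proper subspace of `𝓀ⁿ` lies in a hyperplane: the kernel of a non-zero functional
vanishing on it. [folklore] -/
theorem exists_le_finrank_eq_sub_one {C : Submodule 𝓀[F] (Fin n → 𝓀[F])} (hC : C ≠ ⊤) :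
    ∃ Y : Submodule 𝓀[F] (Fin n → 𝓀[F]), Module.finrank 𝓀[F] Y = n - 1 ∧ C ≤ Y := by
  obtain ⟨f, hf, hfC⟩ := Submodule.exists_dual_map_eq_bot_of_lt_top (lt_top_iff_ne_top.2 hC)
    inferInstance
  refine ⟨LinearMap.ker f, ?_, (LinearMap.le_ker_iff_map).2 hfC⟩
  have h := Module.Dual.finrank_ker_add_one_of_ne_zero hf
  rw [Module.finrank_fin_fun] at h
  omega

/-- **Factorisation through `K t_1 K`.** Every coset `w K` with `w ∈ Δ_{m+1}` is `y • γ` with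
`y K ⊆ K t_1 K` and `γ ∈ Δ_m K / K`: the residue of `w` is singular, so some hyperplane of `𝓀ⁿ`
contains its column space, i.e. (by the lattice count) `y⁻¹ w` is integral for some
`y K ⊆ K t_1 K`. [folklore] -/
theorem exists_mem_orbit_smul_eq [Finite 𝓀[F]] (hϖ : IsUniformizingElement ϖ) (hn : 1 ≤ n)
    {m : ℕ} {β : GL (Fin n) F ⧸ glInt n F} (hβ : β.out ∈ glIntDet n ϖ (m + 1)) :
    ∃ α ∈ MulAction.orbit (glInt n F)
        ((heckeDiag n (Units.mk0 ϖ hϖ.ne_zero) 1 : GL (Fin n) F) : GL (Fin n) F ⧸ glInt n F),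
      ∃ γ : GL (Fin n) F ⧸ glInt n F, γ.out ∈ glIntDet n ϖ m ∧ α.out • γ = β := by
  classical
  set w := β.out with hw
  obtain ⟨w₀, hw₀⟩ := hβ.1.exists_map
  -- a hyperplane containing the column space of the residue matrix
  have hne := span_cols_residue_ne_top hϖ (Nat.le_add_left 1 m) w₀ (by rw [hw₀]; exact hβ.2)
  obtain ⟨Y, hY⟩ := exists_le_finrank_eq_sub_one hne
  -- hence a coset `y K ⊆ K t_1 K` with `y⁻¹ w` integral
  have hcount := ncard_orbit_heckeDiag_isIntegralMatrix hϖ hn w₀ hw₀.symm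
  haveI : Finite (Fin n → 𝓀[F]) := inferInstance
  have hpos : {α ∈ MulAction.orbit (glInt n F)
      ((heckeDiag n (Units.mk0 ϖ hϖ.ne_zero) 1 : GL (Fin n) F) : GL (Fin n) F ⧸ glInt n F) |
        IsIntegralMatrix (((α.out)⁻¹ * w : GL (Fin n) F) : Matrix (Fin n) (Fin n) F)}.ncard ≠ 0 := by
    rw [hcount]
    haveI : Nonempty {Y : Submodule 𝓀[F] (Fin n → 𝓀[F]) // Module.finrank 𝓀[F] Y = n - 1 ∧
      Submodule.span 𝓀[F] (Set.range fun j => fun i => IsLocalRing.residue 𝒪[F] (w₀ i j)) ≤ Y} :=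
      ⟨⟨Y, hY⟩⟩
    exact Nat.card_pos.ne'
  obtain ⟨α, hα, hint⟩ := Set.nonempty_of_ncard_ne_zero hpos
  refine ⟨α, hα, α.out⁻¹ • β, ?_, smul_inv_smul _ _⟩
  rw [smul_out_mem_glIntDet_iff']
  exact inv_mul_mem_delta hϖ (out_mem_glIntDet_of_mem_orbit hϖ hn hα).2
    (by rw [add_comm]; exact hβ.2) hint

/-- The orbit `K · t_r K` (the left cosets in `K t_r K`) is finite, being the image of the finite
transversal `heckeTransversal`. [folklore] -/
theorem finite_orbit_heckeDiag [Finite 𝓀[F]] (hϖ : IsUniformizingElement ϖ) {r : ℕ} (hr : r ≤ n) :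
    (MulAction.orbit (glInt n F)
      ((heckeDiag n (Units.mk0 ϖ hϖ.ne_zero) r : GL (Fin n) F) : GL (Fin n) F ⧸ glInt n F)).Finite :=
  Set.Finite.of_surjOn _ (bijOn_heckeTransversal hϖ hr).surjOn (Finset.finite_toSet _)

/-- **Finiteness of `Δ_m K / K`** (finitely many left cosets of integral matrices of given
determinant valuation): by induction on `m` through the factorisation
`Δ_{m+1} K ⊆ (K t_1 K) · (Δ_m K)`. [folklore] -/
theorem finite_cosets_glIntDet [Finite 𝓀[F]] (hϖ : IsUniformizingElement ϖ) (m : ℕ) :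
    {γ : GL (Fin n) F ⧸ glInt n F | γ.out ∈ glIntDet n ϖ m}.Finite := by
  induction m with
  | zero =>
    refine (Set.finite_singleton ((1 : GL (Fin n) F) : GL (Fin n) F ⧸ glInt n F)).subset ?_
    intro γ hγ
    exact (out_mem_glIntDet_zero_iff γ).1 hγ
  | succ m ih =>
    rcases Nat.eq_zero_or_pos n with hn | hn
    · convert Set.finite_empty
      ext γ
      simp only [Set.mem_setOf_eq, Set.mem_empty_iff_false, iff_false]
      rw [glIntDet_eq_empty_of_eq_zero hϖ hn (Nat.le_add_left 1 m)]
      exact Set.notMem_empty _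
    · refine ((finite_orbit_heckeDiag hϖ hn).biUnion fun α _ => ih.image (α.out • ·)).subset ?_
      intro β hβ
      obtain ⟨α, hα, γ, hγ, rfl⟩ := exists_mem_orbit_smul_eq hϖ hn hβ
      exact Set.mem_biUnion hα ⟨γ, hγ, rfl⟩

end Cosets

/-! ### The operators `T(ϖ^m)` on `K`-fixed vectors -/

section Operators

variable {ϖ : F} {k V : Type*} [CommRing k] [AddCommGroup V] [Module k V]
  (ρ : Representation k (GL (Fin n) F) V)

/-- `T(ϖ^m)` as a finite sum over the cosets `Δ_m K / K` (with `Quotient.out` representatives).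
[folklore] -/
theorem heckeDetOperator_apply_eq_sum (m : ℕ)
    (hfin : {γ : GL (Fin n) F ⧸ glInt n F | γ.out ∈ glIntDet n ϖ m}.Finite) (v : V) :
    heckeDetOperator ρ ϖ m v = ∑ γ ∈ hfin.toFinset, ρ γ.out v := by
  rw [heckeDetOperator, finsum_mem_eq_finite_toFinset_sum _ hfin, LinearMap.sum_apply]

/-- `T(ϖ^m)` preserves the `K`-fixed vectors (reindex the sum along `γ ↦ κ • γ`). [folklore] -/
theorem heckeDetOperator_apply_mem_fixedPoints (m : ℕ)
    (hfin : {γ : GL (Fin n) F ⧸ glInt n F | γ.out ∈ glIntDet n ϖ m}.Finite) {v : V}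
    (hv : v ∈ ρ.fixedPoints (glInt n F)) :
    heckeDetOperator ρ ϖ m v ∈ ρ.fixedPoints (glInt n F) := by
  classical
  rw [ρ.mem_fixedPoints]
  intro x hx
  rw [heckeDetOperator_apply_eq_sum ρ m hfin, map_sum]
  refine Finset.sum_nbij (fun y => (⟨x, hx⟩ : glInt n F) • y) (fun y hy => ?_)
    (fun y _ z _ h => ?_) (fun z hz => ?_) (fun y _ => ?_)
  · rw [Set.Finite.mem_toFinset] at hy ⊢
    exact (smul_out_mem_glIntDet_iff _ _).2 hy
  · exact smul_left_cancel _ h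
  · rw [Finset.mem_coe, Set.Finite.mem_toFinset] at hz
    refine ⟨(⟨x, hx⟩ : glInt n F)⁻¹ • z, ?_, smul_inv_smul _ _⟩
    rw [Finset.mem_coe, Set.Finite.mem_toFinset]
    exact (smul_out_mem_glIntDet_iff _ _).2 hz
  · rw [← Module.End.mul_apply, ← map_mul]
    exact apply_mul_out_eq ρ (glInt n F) hv x y

/-- `T(ϖ^0) v = v` on `V^K` (`Δ_0 K / K = {K}`). [folklore] -/
theorem heckeDetOperator_zero_apply {v : V} (hv : v ∈ ρ.fixedPoints (glInt n F)) :
    heckeDetOperator ρ ϖ 0 v = v := by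
  have hset : {γ : GL (Fin n) F ⧸ glInt n F | γ.out ∈ glIntDet n ϖ 0} =
      {((1 : GL (Fin n) F) : GL (Fin n) F ⧸ glInt n F)} := by
    ext γ
    rw [Set.mem_setOf_eq, Set.mem_singleton_iff, out_mem_glIntDet_zero_iff]
  rw [heckeDetOperator, hset, finsum_mem_singleton]
  obtain ⟨h, H⟩ := QuotientGroup.mk_out_eq_mul (glInt n F) (1 : GL (Fin n) F)
  rw [H, one_mul]
  exact (ρ.mem_fixedPoints _ v).1 hv _ h.2

/-- **`T(ϖ^m)` is the sum of the double-coset operators `[K t K]` over the `K`-double cosets in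
`Δ_m`**, in the following usable form: if every `[K g K]`, `g ∈ Δ_m`, acts on the `K`-fixed
vector `v` by a scalar, then so does `T(ϖ^m)` (group the cosets `Δ_m K / K` into `K`-orbits; on
each orbit `K · gK` the partial sum is `[K g K] v`, `heckeOperator_apply_eq_sum_out`). This is the
form in which Tamagawa's identity is applied to spherical vectors of the global theory, where the
unramified Hecke operators act by scalars. [folklore] -/
theorem exists_heckeDetOperator_apply_eq_smul (m : ℕ)
    (hfin : {γ : GL (Fin n) F ⧸ glInt n F | γ.out ∈ glIntDet n ϖ m}.Finite) {v : V}
    (hv : v ∈ ρ.fixedPoints (glInt n F))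
    (h : ∀ g ∈ glIntDet n ϖ m, ∃ c : k, heckeOperator ρ (glInt n F) g v = c • v) :
    ∃ c : k, heckeDetOperator ρ ϖ m v = c • v := by
  classical
  set B := hfin.toFinset with hB
  -- group the sum over `B = Δ_m K / K` along the orbit map
  have hsum : heckeDetOperator ρ ϖ m v =
      ∑ O ∈ B.image (fun γ => MulAction.orbit (glInt n F) γ),
        ∑ γ ∈ B.filter (fun γ => MulAction.orbit (glInt n F) γ = O), ρ γ.out v := by
    rw [heckeDetOperator_apply_eq_sum ρ m hfin, Finset.sum_fiberwise_of_maps_to]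
    intro γ hγ
    exact Finset.mem_image_of_mem _ hγ
  -- each fibre is a whole orbit `K · (γ₀ K)`, on which the sum is `[K γ₀.out K] v`
  have hfib : ∀ O ∈ B.image (fun γ => MulAction.orbit (glInt n F) γ), ∃ c : k,
      ∑ γ ∈ B.filter (fun γ => MulAction.orbit (glInt n F) γ = O), ρ γ.out v = c • v := by
    intro O hO
    obtain ⟨γ₀, hγ₀, rfl⟩ := Finset.mem_image.1 hO
    rw [hB, Set.Finite.mem_toFinset, Set.mem_setOf_eq] at hγ₀
    have horb : (MulAction.orbit (glInt n F) (γ₀.out : GL (Fin n) F ⧸ glInt n F)) =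
        MulAction.orbit (glInt n F) γ₀ := by rw [QuotientGroup.out_eq']
    have hfinO : (MulAction.orbit (glInt n F) (γ₀.out : GL (Fin n) F ⧸ glInt n F)).Finite := by
      rw [horb]
      refine hfin.subset fun γ hγ => ?_
      obtain ⟨κ, rfl⟩ := hγ
      exact (smul_out_mem_glIntDet_iff κ γ₀).2 hγ₀
    obtain ⟨c, hc⟩ := h γ₀.out hγ₀
    refine ⟨c, ?_⟩
    rw [← hc, heckeOperator_apply_eq_sum_out ρ (glInt n F) _ hfinO hv]
    refine Finset.sum_congr ?_ fun _ _ => rfl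
    ext γ
    rw [Finset.mem_filter, hB, Set.Finite.mem_toFinset, Set.Finite.mem_toFinset, Set.mem_setOf_eq,
      horb]
    constructor
    · rintro ⟨-, hγ⟩
      rw [← hγ]
      exact MulAction.mem_orbit_self γ
    · intro hγ
      obtain ⟨κ, rfl⟩ := hγ
      exact ⟨(smul_out_mem_glIntDet_iff κ γ₀).2 hγ₀, MulAction.orbit_smul κ γ₀⟩
  choose! c hc using hfib
  refine ⟨∑ O ∈ B.image (fun γ => MulAction.orbit (glInt n F) γ), c O, ?_⟩
  rw [hsum, Finset.sum_smul]
  exact Finset.sum_congr rfl fun O hO => hc O hO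

/-- **Product formula `[KxK] ∘ T(ϖ^m)`.** For `v ∈ V^K`, a finite double coset `KxK/K` and
finite `Δ_m K / K`:
`[KxK] (T(ϖ^m) v) = ∑ᶠ_{γ ∈ G/K} #{α ∈ KxK/K : α⁻¹ γ ∈ Δ_m K/K} • ρ(γ) v`
(the analogue of `heckeOperator_heckeOperator_apply`, same regrouping of the double sum along
`β ↦ α β`; Shimura (1971), §3.1, Prop. 3.15 for the structure constants as lattice counts).
[folklore] -/
theorem heckeOperator_heckeDetOperator_apply (x : GL (Fin n) F)
    (hx : (MulAction.orbit (glInt n F) (x : GL (Fin n) F ⧸ glInt n F)).Finite) (m : ℕ)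
    (hfin : {γ : GL (Fin n) F ⧸ glInt n F | γ.out ∈ glIntDet n ϖ m}.Finite) {v : V}
    (hv : v ∈ ρ.fixedPoints (glInt n F)) :
    heckeOperator ρ (glInt n F) x (heckeDetOperator ρ ϖ m v) =
      ∑ᶠ γ : GL (Fin n) F ⧸ glInt n F,
        ({α ∈ MulAction.orbit (glInt n F) (x : GL (Fin n) F ⧸ glInt n F) |
            (α.out⁻¹ • γ).out ∈ glIntDet n ϖ m}.ncard : k) • ρ γ.out v := by
  classical
  have hyv : heckeDetOperator ρ ϖ m v ∈ ρ.fixedPoints (glInt n F) :=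
    heckeDetOperator_apply_mem_fixedPoints ρ m hfin hv
  rw [heckeOperator_apply_eq_sum_out ρ (glInt n F) x hx hyv]
  simp_rw [heckeDetOperator_apply_eq_sum ρ m hfin, map_sum]
  -- regroup the inner sums along `β ↦ α.out • β`
  have hinner : ∀ α : GL (Fin n) F ⧸ glInt n F, ∑ β ∈ hfin.toFinset, ρ α.out (ρ β.out v) =
      ∑ γ ∈ hfin.toFinset.image (α.out • ·), ρ γ.out v := by
    intro α
    rw [Finset.sum_image (fun β _ β' _ h => smul_left_cancel α.out h)]
    refine Finset.sum_congr rfl fun β _ => ?_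
    rw [← Module.End.mul_apply, ← map_mul, apply_mul_out_eq ρ (glInt n F) hv]
  simp_rw [hinner]
  -- the support of the right-hand side
  set U : Finset (GL (Fin n) F ⧸ glInt n F) :=
    hx.toFinset.biUnion fun α => hfin.toFinset.image (α.out • ·) with hU
  have hmemU : ∀ {α γ : GL (Fin n) F ⧸ glInt n F},
      (γ ∈ hfin.toFinset.image (α.out • ·) ↔ (α.out⁻¹ • γ).out ∈ glIntDet n ϖ m) := by
    intro α γ
    rw [Finset.mem_image]
    constructor
    · rintro ⟨β, hβ, rfl⟩
      rw [inv_smul_smul]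
      exact (Set.Finite.mem_toFinset hfin).1 hβ
    · intro h
      exact ⟨α.out⁻¹ • γ, (Set.Finite.mem_toFinset hfin).2 h, smul_inv_smul _ _⟩
  have hcount : ∀ γ : GL (Fin n) F ⧸ glInt n F,
      {α ∈ MulAction.orbit (glInt n F) (x : GL (Fin n) F ⧸ glInt n F) |
          (α.out⁻¹ • γ).out ∈ glIntDet n ϖ m}.ncard =
        (hx.toFinset.filter fun α => γ ∈ hfin.toFinset.image (α.out • ·)).card := by
    intro γ
    rw [← Set.ncard_coe_finset]
    congr 1
    ext α
    simp only [Set.mem_setOf_eq, Finset.coe_filter, Set.Finite.mem_toFinset]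
    rw [hmemU]
  have hsupp : ∀ γ : GL (Fin n) F ⧸ glInt n F, γ ∉ U →
      {α ∈ MulAction.orbit (glInt n F) (x : GL (Fin n) F ⧸ glInt n F) |
          (α.out⁻¹ • γ).out ∈ glIntDet n ϖ m}.ncard = 0 := by
    intro γ hγ
    rw [hcount, Finset.card_eq_zero, Finset.filter_eq_empty_iff]
    intro α hα h
    exact hγ (Finset.mem_biUnion.2 ⟨α, hα, h⟩)
  rw [finsum_eq_sum_of_support_subset _ (s := U)]
  · have : ∀ α ∈ hx.toFinset, ∑ γ ∈ hfin.toFinset.image (α.out • ·), ρ γ.out v =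
        ∑ γ ∈ U, if γ ∈ hfin.toFinset.image (α.out • ·) then ρ γ.out v else 0 := by
      intro α hα
      rw [← Finset.sum_filter, Finset.filter_mem_eq_inter, Finset.inter_eq_right.2]
      exact Finset.subset_biUnion_of_mem (fun α => hfin.toFinset.image (α.out • ·)) hα
    rw [Finset.sum_congr rfl this, Finset.sum_comm]
    refine Finset.sum_congr rfl fun γ _ => ?_
    rw [Finset.sum_ite, Finset.sum_const_zero, add_zero, Finset.sum_const, hcount,
      Nat.cast_smul_eq_nsmul]
  · intro γ hγ
    by_contra h
    apply hγ
    change (({α ∈ MulAction.orbit (glInt n F) (x : GL (Fin n) F ⧸ glInt n F) |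
        (α.out⁻¹ • γ).out ∈ glIntDet n ϖ m}.ncard : ℕ) : k) • ρ γ.out v = 0
    rw [hsupp γ (by simpa using h), Nat.cast_zero, zero_smul]

end Operators

/-! ### Tamagawa's identity -/

section Tamagawa

variable {ϖ : F} {k V : Type*} [CommRing k] [AddCommGroup V] [Module k V]
  (ρ : Representation k (GL (Fin n) F) V)

/-- **The structure constants of `T_i · T(ϖ^m)` as subspace counts (Shimura, Lemma 3.22).** For
`γ = w K` with `w ∈ Δ_{i+m}` (`w = w₀` over `𝒪`): the number of `α ∈ K t_i K / K` with
`α⁻¹ γ ∈ Δ_m K / K` is the number of subspaces `Y ≤ 𝓀ⁿ` of dimension `n - i` containing the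
column space of the residue matrix `w̄₀` — Shimura's count `μ(d) = c_i^{(k)}` of the lattices `M`
with `N ⊆ M ⊆ L`, `L/M ≅ 𝔽^i` (*loc. cit.*, proof of Lemma 3.22). [cite: ShimuraIATAF1971, Lemma 3.22] -/
theorem ncard_orbit_heckeDiag_smul_out_mem [Finite 𝓀[F]] (hϖ : IsUniformizingElement ϖ)
    {i : ℕ} (hi : i ≤ n) {m : ℕ} {γ : GL (Fin n) F ⧸ glInt n F}
    (hγ : γ.out ∈ glIntDet n ϖ (i + m)) (w₀ : Matrix (Fin n) (Fin n) 𝒪[F])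
    (hw : ((γ.out : GL (Fin n) F) : Matrix (Fin n) (Fin n) F) = w₀.map (𝒪[F]).subtype) :
    {α ∈ MulAction.orbit (glInt n F)
        ((heckeDiag n (Units.mk0 ϖ hϖ.ne_zero) i : GL (Fin n) F) : GL (Fin n) F ⧸ glInt n F) |
      (α.out⁻¹ • γ).out ∈ glIntDet n ϖ m}.ncard =
    Nat.card {Y : Submodule 𝓀[F] (Fin n → 𝓀[F]) // Module.finrank 𝓀[F] Y = n - i ∧
      Submodule.span 𝓀[F] (Set.range fun j => fun i =>
        IsLocalRing.residue 𝒪[F] (w₀ i j)) ≤ Y} := by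
  rw [← ncard_orbit_heckeDiag_isIntegralMatrix hϖ hi w₀ hw]
  congr 1
  ext α
  simp only [Set.mem_setOf_eq]
  refine and_congr_right fun hα => ?_
  rw [smul_out_mem_glIntDet_iff']
  exact ⟨fun h => h.1, fun h => inv_mul_mem_delta hϖ (out_mem_glIntDet_of_mem_orbit hϖ hi hα).2
    hγ.2 h⟩

/-- The structure constants of `T_i · T(ϖ^m)` vanish off `Δ_{i+m} K / K`
(`Δ_i Δ_m ⊆ Δ_{i+m}`). [folklore] -/
theorem ncard_orbit_heckeDiag_smul_out_mem_eq_zero [Finite 𝓀[F]] (hϖ : IsUniformizingElement ϖ) {i : ℕ}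
    (hi : i ≤ n) {m : ℕ} {γ : GL (Fin n) F ⧸ glInt n F} (hγ : γ.out ∉ glIntDet n ϖ (i + m)) :
    {α ∈ MulAction.orbit (glInt n F)
        ((heckeDiag n (Units.mk0 ϖ hϖ.ne_zero) i : GL (Fin n) F) : GL (Fin n) F ⧸ glInt n F) |
      (α.out⁻¹ • γ).out ∈ glIntDet n ϖ m}.ncard = 0 := by
  rw [Set.ncard_eq_zero (hs := (finite_orbit_heckeDiag hϖ hi).subset (Set.sep_subset _ _))]
  ext α
  simp only [Set.mem_setOf_eq, Set.mem_empty_iff_false, iff_false, not_and]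
  intro hα h
  rw [smul_out_mem_glIntDet_iff'] at h
  apply hγ
  have := mul_mem_delta (out_mem_glIntDet_of_mem_orbit hϖ hi hα) h
  rwa [mul_inv_cancel_left] at this

/-- For `w ∈ Δ_m` and `i > m` no `α ∈ K t_i K / K` has `α⁻¹ w` integral, so no subspace of
dimension `n - i` contains the column space of `w̄₀`: the subspace counts vanish beyond `i = m`
(equivalently, `rank w̄₀ ≥ n - m`). [folklore] -/
theorem card_submodule_ge_cols_eq_zero [Finite 𝓀[F]] (hϖ : IsUniformizingElement ϖ) {i m : ℕ}
    (hi : i ≤ n) (hmi : m < i) (w₀ : Matrix (Fin n) (Fin n) 𝒪[F]) {w : GL (Fin n) F}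
    (hw : (w : Matrix (Fin n) (Fin n) F) = w₀.map (𝒪[F]).subtype) (hwm : w ∈ glIntDet n ϖ m) :
    Nat.card {Y : Submodule 𝓀[F] (Fin n → 𝓀[F]) // Module.finrank 𝓀[F] Y = n - i ∧
      Submodule.span 𝓀[F] (Set.range fun j => fun i =>
        IsLocalRing.residue 𝒪[F] (w₀ i j)) ≤ Y} = 0 := by
  rw [← ncard_orbit_heckeDiag_isIntegralMatrix hϖ hi w₀ hw,
    Set.ncard_eq_zero (hs := (finite_orbit_heckeDiag hϖ hi).subset (Set.sep_subset _ _))]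
  ext α
  simp only [Set.mem_setOf_eq, Set.mem_empty_iff_false, iff_false, not_and]
  intro hα
  exact not_isIntegralMatrix_inv_mul hϖ hmi (out_mem_glIntDet_of_mem_orbit hϖ hi hα).2 hwm.2

/-- Codimension bookkeeping: for `i ≤ n`, `dim Y = n - i` iff `dim Y + i = dim 𝓀ⁿ`. [folklore] -/
theorem card_submodule_finrank_eq_sub (C : Submodule 𝓀[F] (Fin n → 𝓀[F])) {i : ℕ} (hi : i ≤ n) :
    Nat.card {Y : Submodule 𝓀[F] (Fin n → 𝓀[F]) // Module.finrank 𝓀[F] Y = n - i ∧ C ≤ Y} =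
      Nat.card {Y : Submodule 𝓀[F] (Fin n → 𝓀[F]) // C ≤ Y ∧
        Module.finrank 𝓀[F] Y + i = Module.finrank 𝓀[F] (Fin n → 𝓀[F])} := by
  refine Nat.card_congr (Equiv.subtypeEquivRight fun Y => ?_)
  rw [Module.finrank_fin_fun]
  constructor
  · rintro ⟨h1, h2⟩; exact ⟨h2, by omega⟩
  · rintro ⟨h1, h2⟩; exact ⟨by omega, h1⟩

/-- **Tamagawa's rationality theorem for the Hecke series of `GL_n` (Shimura, Thm. 3.21), in
operator form.** Let `F` be a field with a valuation whose residue field `𝓀` is finite with `q`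
elements, `ϖ` a uniformizer, `K = GL_n(𝒪)`, `T_i = [K diag(ϖ 1_i, 1_{n-i}) K]` the Hecke
operators (`heckeT`) and `T(ϖ^m) = ∑_{yK ⊆ Δ_m} ρ(y)` (`heckeDetOperator`) on a representation
`ρ` of `GL_n(F)` over a commutative ring `k`. Then on every `K`-fixed vector `v` and for every
`m ≥ 1`,

`∑_{i=0}^{min(m,n)} (-1)^i q^{i(i-1)/2} T_i (T(ϖ^{m-i}) v) = 0`,

i.e. `(∑_{i=0}^{n} (-1)^i q^{i(i-1)/2} T_i X^i) · (∑_{m ≥ 0} T(ϖ^m) X^m) = 1` coefficientwise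
(with `T(ϖ^0) = 1`, `heckeDetOperator_zero_apply`). Proof as in Shimura (1971), Lemmas 3.22–3.23:
by the product formula the coefficient of `ρ(w) v` (`w ∈ Δ_m`) is
`∑_i (-1)^i q^{i(i-1)/2} #{Y ≤ 𝓀ⁿ : dim Y = n - i, Y ⊇ C(w̄)}`, which vanishes because the
column space `C(w̄)` of the (singular) residue matrix is a proper subspace
(`Literature.LinearAlgebra.Subspace.sum_neg_one_pow_mul_pow_choose_mul_card_ge_codim_eq_zero`).
(Tamagawa (1963); Shimura (1971), Thm. 3.21; Andrianov–Zhuravlev, *Modular forms and Hecke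
operators*, Ch. 3 §2.) [cite: ShimuraIATAF1971, Theorem 3.21] -/
theorem sum_heckeOperator_heckeDetOperator_eq_zero [Finite 𝓀[F]] (hϖ : IsUniformizingElement ϖ)
    {m : ℕ} (hm : 1 ≤ m) {v : V} (hv : v ∈ ρ.fixedPoints (glInt n F)) :
    ∑ i ∈ Finset.range (min m n + 1), ((-1 : k) ^ i * (Nat.card 𝓀[F] : k) ^ i.choose 2) •
      heckeOperator ρ (glInt n F) (heckeDiag n (Units.mk0 ϖ hϖ.ne_zero) i)
        (heckeDetOperator ρ ϖ (m - i) v) = 0 := by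
  classical
  have hB := finite_cosets_glIntDet (n := n) hϖ m
  -- each term as a sum over `Δ_m K / K`
  have hterm : ∀ i ∈ Finset.range (min m n + 1),
      heckeOperator ρ (glInt n F) (heckeDiag n (Units.mk0 ϖ hϖ.ne_zero) i)
        (heckeDetOperator ρ ϖ (m - i) v) =
        ∑ γ ∈ hB.toFinset, ({α ∈ MulAction.orbit (glInt n F)
            ((heckeDiag n (Units.mk0 ϖ hϖ.ne_zero) i : GL (Fin n) F) : GL (Fin n) F ⧸ glInt n F) |
          (α.out⁻¹ • γ).out ∈ glIntDet n ϖ (m - i)}.ncard : k) • ρ γ.out v := by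
    intro i hi
    rw [Finset.mem_range] at hi
    have hin : i ≤ n := by omega
    rw [heckeOperator_heckeDetOperator_apply ρ _ (finite_orbit_heckeDiag hϖ hin)
      (m - i) (finite_cosets_glIntDet hϖ (m - i)) hv,
      finsum_eq_sum_of_support_subset _ (s := hB.toFinset)]
    intro γ hγ
    rw [Finset.mem_coe, Set.Finite.mem_toFinset, Set.mem_setOf_eq]
    by_contra hγm
    apply hγ
    beta_reduce
    rw [ncard_orbit_heckeDiag_smul_out_mem_eq_zero hϖ hin
      (by rwa [Nat.add_sub_cancel' (by omega : i ≤ m)]), Nat.cast_zero, zero_smul]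
  rw [Finset.sum_congr rfl fun i hi => by rw [hterm i hi]]
  simp_rw [Finset.smul_sum, smul_smul]
  rw [Finset.sum_comm]
  refine Finset.sum_eq_zero fun γ hγ => ?_
  rw [← Finset.sum_smul]
  -- the coefficient of `ρ(γ.out) v` vanishes
  suffices hcoef : ∑ i ∈ Finset.range (min m n + 1), (-1 : k) ^ i * (Nat.card 𝓀[F] : k) ^
      i.choose 2 * ({α ∈ MulAction.orbit (glInt n F)
          ((heckeDiag n (Units.mk0 ϖ hϖ.ne_zero) i : GL (Fin n) F) : GL (Fin n) F ⧸ glInt n F) |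
        (α.out⁻¹ • γ).out ∈ glIntDet n ϖ (m - i)}.ncard : k) = 0 by
    rw [hcoef, zero_smul]
  rw [Set.Finite.mem_toFinset, Set.mem_setOf_eq] at hγ
  obtain ⟨w₀, hw₀⟩ := hγ.1.exists_map
  set C : Submodule 𝓀[F] (Fin n → 𝓀[F]) :=
    Submodule.span 𝓀[F] (Set.range fun j => fun i => IsLocalRing.residue 𝒪[F] (w₀ i j)) with hC
  have hCtop : C ≠ ⊤ := span_cols_residue_ne_top hϖ hm w₀ (by rw [hw₀]; exact hγ.2)
  -- the counts as subspace counts, for all `i ≤ n`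
  have hcnt : ∀ i ∈ Finset.range (min m n + 1), ({α ∈ MulAction.orbit (glInt n F)
          ((heckeDiag n (Units.mk0 ϖ hϖ.ne_zero) i : GL (Fin n) F) : GL (Fin n) F ⧸ glInt n F) |
        (α.out⁻¹ • γ).out ∈ glIntDet n ϖ (m - i)}.ncard : k) =
      (Nat.card {Y : Submodule 𝓀[F] (Fin n → 𝓀[F]) // C ≤ Y ∧
        Module.finrank 𝓀[F] Y + i = Module.finrank 𝓀[F] (Fin n → 𝓀[F])} : k) := by
    intro i hi
    rw [Finset.mem_range] at hi
    have hin : i ≤ n := by omega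
    rw [ncard_orbit_heckeDiag_smul_out_mem hϖ hin (m := m - i)
      (by rwa [Nat.add_sub_cancel' (by omega : i ≤ m)]) w₀ hw₀.symm,
      card_submodule_finrank_eq_sub C hin]
  rw [Finset.sum_congr rfl fun i hi => by rw [hcnt i hi]]
  -- extend the sum to `i ≤ n` (the extra counts vanish) and apply the Möbius identity
  have hmoeb := Literature.LinearAlgebra.Subspace.sum_neg_one_pow_mul_pow_choose_mul_card_ge_codim_eq_zero
    (k := 𝓀[F]) (W := Fin n → 𝓀[F]) hCtop
  rw [Module.finrank_fin_fun] at hmoeb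
  have hext : ∑ i ∈ Finset.range (min m n + 1), (-1 : k) ^ i * (Nat.card 𝓀[F] : k) ^ i.choose 2 *
      (Nat.card {Y : Submodule 𝓀[F] (Fin n → 𝓀[F]) // C ≤ Y ∧
        Module.finrank 𝓀[F] Y + i = Module.finrank 𝓀[F] (Fin n → 𝓀[F])} : k) =
      ∑ i ∈ Finset.range (n + 1), (-1 : k) ^ i * (Nat.card 𝓀[F] : k) ^ i.choose 2 *
      (Nat.card {Y : Submodule 𝓀[F] (Fin n → 𝓀[F]) // C ≤ Y ∧
        Module.finrank 𝓀[F] Y + i = Module.finrank 𝓀[F] (Fin n → 𝓀[F])} : k) := by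
    refine Finset.sum_subset (Finset.range_subset_range.2 (by omega)) fun i hi hi' => ?_
    rw [Finset.mem_range] at hi hi'
    have hin : i ≤ n := by omega
    rw [← card_submodule_finrank_eq_sub C hin, card_submodule_ge_cols_eq_zero hϖ hin (by omega)
      w₀ hw₀.symm hγ, Nat.cast_zero, mul_zero]
  rw [hext]
  have := congrArg (Int.cast : ℤ → k) hmoeb
  rw [Int.cast_zero] at this
  rw [← this, Int.cast_sum]
  refine Finset.sum_congr rfl fun i _ => ?_
  rw [Module.finrank_fin_fun]
  push_cast
  ring

/-- **Tamagawa's identity (operator form) for complex representations**, with the Hecke operators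
`heckeT ρ ϖ i = T_i` of `SatakeParametersGL`. [cite: ShimuraIATAF1971, Theorem 3.21] -/
theorem sum_heckeT_heckeDetOperator_eq_zero {V : Type*} [AddCommGroup V] [Module ℂ V]
    (ρ : Representation ℂ (GL (Fin n) F) V) [Finite 𝓀[F]] (hϖ : IsUniformizingElement ϖ)
    {m : ℕ} (hm : 1 ≤ m) {v : V} (hv : v ∈ ρ.fixedPoints (glInt n F)) :
    ∑ i ∈ Finset.range (min m n + 1), ((-1 : ℂ) ^ i * (Nat.card 𝓀[F] : ℂ) ^ i.choose 2) •
      heckeT ρ (Units.mk0 ϖ hϖ.ne_zero) i (heckeDetOperator ρ ϖ (m - i) v) = 0 :=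
  sum_heckeOperator_heckeDetOperator_eq_zero ρ hϖ hm hv

end Tamagawa

/-! ### Corollaries: the number of cosets, eigenvalues, and the formal Hecke series -/

section Corollaries

variable {ϖ : F}

/-- **The number of left cosets in `Δ_m`** is at most `#(K t_1 K / K)^m` (from the factorisation
`Δ_{m+1} K ⊆ (K t_1 K)(Δ_m K)`); with `#(K t_1 K / K) = (q^n - 1)/(q - 1)` this is the crude
bound `#(Δ_m K/K) ≤ ((q^n-1)/(q-1))^m` used for the absolute convergence of Hecke series.
[folklore] -/
theorem ncard_cosets_glIntDet_le [Finite 𝓀[F]] (hϖ : IsUniformizingElement ϖ) (hn : 1 ≤ n)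
    (m : ℕ) :
    {γ : GL (Fin n) F ⧸ glInt n F | γ.out ∈ glIntDet n ϖ m}.ncard ≤
      (MulAction.orbit (glInt n F) ((heckeDiag n (Units.mk0 ϖ hϖ.ne_zero) 1 : GL (Fin n) F) :
        GL (Fin n) F ⧸ glInt n F)).ncard ^ m := by
  classical
  induction m with
  | zero =>
    rw [pow_zero, Set.ncard_le_one_iff (hs := finite_cosets_glIntDet hϖ 0)]
    intro γ γ' hγ hγ'
    rw [(out_mem_glIntDet_zero_iff γ).1 hγ, (out_mem_glIntDet_zero_iff γ').1 hγ']
  | succ m ih =>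
    have horb := finite_orbit_heckeDiag (n := n) hϖ hn
    have hB := finite_cosets_glIntDet (n := n) hϖ m
    calc {γ : GL (Fin n) F ⧸ glInt n F | γ.out ∈ glIntDet n ϖ (m + 1)}.ncard
        ≤ (⋃ α ∈ MulAction.orbit (glInt n F) ((heckeDiag n (Units.mk0 ϖ hϖ.ne_zero) 1 :
            GL (Fin n) F) : GL (Fin n) F ⧸ glInt n F),
            (α.out • ·) '' {γ : GL (Fin n) F ⧸ glInt n F | γ.out ∈ glIntDet n ϖ m}).ncard := by
          refine Set.ncard_le_ncard (fun β hβ => ?_) (horb.biUnion fun α _ => hB.image _)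
          obtain ⟨α, hα, γ, hγ, rfl⟩ := exists_mem_orbit_smul_eq hϖ hn hβ
          exact Set.mem_biUnion hα ⟨γ, hγ, rfl⟩
      _ ≤ ∑ α ∈ horb.toFinset,
            ((α.out • ·) '' {γ : GL (Fin n) F ⧸ glInt n F | γ.out ∈ glIntDet n ϖ m}).ncard := by
          have e : (⋃ α ∈ MulAction.orbit (glInt n F) ((heckeDiag n (Units.mk0 ϖ hϖ.ne_zero) 1 :
              GL (Fin n) F) : GL (Fin n) F ⧸ glInt n F),
              (α.out • ·) '' {γ : GL (Fin n) F ⧸ glInt n F | γ.out ∈ glIntDet n ϖ m}) =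
              ⋃ α ∈ horb.toFinset,
                (α.out • ·) '' {γ : GL (Fin n) F ⧸ glInt n F | γ.out ∈ glIntDet n ϖ m} := by
            simp only [Set.Finite.mem_toFinset]
          rw [e]
          exact Finset.set_ncard_biUnion_le _ _
      _ ≤ ∑ _α ∈ horb.toFinset, {γ : GL (Fin n) F ⧸ glInt n F | γ.out ∈ glIntDet n ϖ m}.ncard :=
          Finset.sum_le_sum fun α _ => Set.ncard_image_le hB
      _ ≤ _ := by
          rw [Finset.sum_const, smul_eq_mul, ← Set.ncard_eq_toFinset_card _ horb, pow_succ']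
          exact Nat.mul_le_mul_left _ ih

variable {k V : Type*} [Field k] [AddCommGroup V] [Module k V]
  (ρ : Representation k (GL (Fin n) F) V)

/-- **Tamagawa's identity for eigenvalues.** If a non-zero `K`-fixed vector `v` is an eigenvector
of the Hecke operators `T_i` (`i ≤ n`, eigenvalues `τ_i`) and of the operators `T(ϖ^m)`
(eigenvalues `r_m`) — e.g. if `dim V^K = 1`, or if all Hecke operators act on `v` by scalars —
then `∑_{i=0}^{min(m,n)} (-1)^i q^{i(i-1)/2} τ_i r_{m-i} = 0` for every `m ≥ 1` (Shimura (1971),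
Thm. 3.21 applied to a one-dimensional representation of the Hecke ring, cf. the remarks after
Thm. 3.24). [cite: ShimuraIATAF1971, Theorem 3.21] -/
theorem sum_heckeEigenvalue_mul_heckeDetEigenvalue_eq_zero [Finite 𝓀[F]] (hϖ : IsUniformizingElement ϖ)
    {v : V} (hv : v ∈ ρ.fixedPoints (glInt n F)) (hv0 : v ≠ 0) {τ r : ℕ → k}
    (hτ : ∀ i ≤ n, heckeOperator ρ (glInt n F) (heckeDiag n (Units.mk0 ϖ hϖ.ne_zero) i) v = τ i • v)
    (hr : ∀ m, heckeDetOperator ρ ϖ m v = r m • v) {m : ℕ} (hm : 1 ≤ m) :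
    ∑ i ∈ Finset.range (min m n + 1),
      (-1 : k) ^ i * (Nat.card 𝓀[F] : k) ^ i.choose 2 * τ i * r (m - i) = 0 := by
  have h := sum_heckeOperator_heckeDetOperator_eq_zero ρ hϖ hm hv
  have hterm : ∀ i ∈ Finset.range (min m n + 1),
      ((-1 : k) ^ i * (Nat.card 𝓀[F] : k) ^ i.choose 2) •
        heckeOperator ρ (glInt n F) (heckeDiag n (Units.mk0 ϖ hϖ.ne_zero) i)
          (heckeDetOperator ρ ϖ (m - i) v) =
        ((-1 : k) ^ i * (Nat.card 𝓀[F] : k) ^ i.choose 2 * τ i * r (m - i)) • v := by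
    intro i hi
    rw [Finset.mem_range] at hi
    rw [hr, map_smul, hτ i (by omega), smul_smul, smul_smul]
    congr 1
    ring
  rw [Finset.sum_congr rfl hterm, ← Finset.sum_smul] at h
  exact (smul_eq_zero.1 h).resolve_right hv0

/-- `T_0 = [K 1 K]` is the identity on `V^K`, so `τ_0 = 1`. [folklore] -/
theorem heckeOperator_heckeDiag_zero_apply {ϖ' : Fˣ} {v : V} (hv : v ∈ ρ.fixedPoints (glInt n F)) :
    heckeOperator ρ (glInt n F) (heckeDiag n ϖ' 0) v = v := by
  have h0 : heckeDiag n ϖ' 0 = 1 := by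
    refine Units.ext ?_
    rw [coe_heckeDiag, Units.val_one]
    simp
  rw [h0]
  exact heckeOperator_one_apply ρ _ hv

/-- **Tamagawa's rationality theorem for the formal Hecke series (Shimura, Thm. 3.21), eigenvalue
form.** Under the hypotheses of `sum_heckeEigenvalue_mul_heckeDetEigenvalue_eq_zero`, the formal power series
`∑_m r_m X^m` of the eigenvalues of `T(ϖ^m)` is the inverse of the Hecke polynomial
`∑_{i=0}^{n} (-1)^i q^{i(i-1)/2} τ_i X^i`:
`(∑_m r_m X^m) · (∑_i (-1)^i q^{i(i-1)/2} τ_i X^i) = 1` in `k⟦X⟧`.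
[cite: ShimuraIATAF1971, Theorem 3.21] -/
theorem mk_heckeDetEigenvalue_mul_heckePolynomial_eq_one [Finite 𝓀[F]]
    (hϖ : IsUniformizingElement ϖ) {v : V} (hv : v ∈ ρ.fixedPoints (glInt n F)) (hv0 : v ≠ 0)
    {τ r : ℕ → k}
    (hτ : ∀ i ≤ n, heckeOperator ρ (glInt n F) (heckeDiag n (Units.mk0 ϖ hϖ.ne_zero) i) v = τ i • v)
    (hr : ∀ m, heckeDetOperator ρ ϖ m v = r m • v) :
    PowerSeries.mk r *
      (∑ i ∈ Finset.range (n + 1), Polynomial.C ((-1 : k) ^ i * (Nat.card 𝓀[F] : k) ^ i.choose 2 *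
        τ i) * Polynomial.X ^ i : Polynomial k) = 1 := by
  classical
  -- `τ_0 = 1` and `r_0 = 1`
  have hτ0 : τ 0 = 1 := by
    have h := hτ 0 (Nat.zero_le n)
    rw [heckeOperator_heckeDiag_zero_apply ρ hv] at h
    have : (1 - τ 0) • v = 0 := by rw [sub_smul, one_smul, ← h, sub_self]
    exact (sub_eq_zero.1 ((smul_eq_zero.1 this).resolve_right hv0)).symm
  have hr0 : r 0 = 1 := by
    have h := hr 0
    rw [heckeDetOperator_zero_apply ρ hv] at h
    have : (1 - r 0) • v = 0 := by rw [sub_smul, one_smul, ← h, sub_self]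
    exact (sub_eq_zero.1 ((smul_eq_zero.1 this).resolve_right hv0)).symm
  -- the coefficients of the Hecke polynomial
  set P : Polynomial k := ∑ i ∈ Finset.range (n + 1), Polynomial.C ((-1 : k) ^ i *
    (Nat.card 𝓀[F] : k) ^ i.choose 2 * τ i) * Polynomial.X ^ i with hP
  have hPcoeff : ∀ i, P.coeff i = if i ≤ n then (-1 : k) ^ i * (Nat.card 𝓀[F] : k) ^ i.choose 2 *
      τ i else 0 := by
    intro i
    rw [hP, Polynomial.finsetSum_coeff]
    simp only [Polynomial.coeff_C_mul, Polynomial.coeff_X_pow, mul_ite, mul_one, mul_zero]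
    rw [Finset.sum_ite_eq]
    simp only [Finset.mem_range, Nat.lt_succ_iff]
  ext m
  rw [PowerSeries.coeff_mul, PowerSeries.coeff_one, Finset.Nat.sum_antidiagonal_eq_sum_range_succ_mk]
  simp only [PowerSeries.coeff_mk, Polynomial.coeff_coe, hPcoeff]
  rcases Nat.eq_zero_or_pos m with rfl | hm
  · simp [hr0, hτ0]
  · rw [if_neg hm.ne']
    -- reorder to the shape of `sum_heckeEigenvalue_mul_heckeDetEigenvalue_eq_zero`
    have h := sum_heckeEigenvalue_mul_heckeDetEigenvalue_eq_zero ρ hϖ hv hv0 hτ hr hm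
    -- both sides are `∑_{i ≤ min m n} (-1)^i q^{C(i,2)} τ_i r_{m-i}`
    have hswap : ∑ i ∈ Finset.range m.succ, r i * (if m - i ≤ n then
        (-1 : k) ^ (m - i) * (Nat.card 𝓀[F] : k) ^ (m - i).choose 2 * τ (m - i) else 0) =
        ∑ i ∈ Finset.range m.succ, (if i ≤ n then
          (-1 : k) ^ i * (Nat.card 𝓀[F] : k) ^ i.choose 2 * τ i else 0) * r (m - i) := by
      rw [← Finset.sum_range_reflect]
      refine Finset.sum_congr rfl fun i hi => ?_
      rw [Finset.mem_range] at hi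
      rw [Nat.succ_sub_one, Nat.sub_sub_self (by omega : i ≤ m), mul_comm]
    rw [hswap]
    calc ∑ i ∈ Finset.range m.succ, (if i ≤ n then
            (-1 : k) ^ i * (Nat.card 𝓀[F] : k) ^ i.choose 2 * τ i else 0) * r (m - i)
        = ∑ i ∈ Finset.range (min m n + 1), (if i ≤ n then
            (-1 : k) ^ i * (Nat.card 𝓀[F] : k) ^ i.choose 2 * τ i else 0) * r (m - i) := by
          symm
          refine Finset.sum_subset (Finset.range_subset_range.2 (by omega : min m n + 1 ≤ m.succ))
            fun i hi hi' => ?_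
          rw [Finset.mem_range] at hi hi'
          rw [if_neg (by omega), zero_mul]
      _ = ∑ i ∈ Finset.range (min m n + 1),
            (-1 : k) ^ i * (Nat.card 𝓀[F] : k) ^ i.choose 2 * τ i * r (m - i) := by
          refine Finset.sum_congr rfl fun i hi => ?_
          rw [Finset.mem_range] at hi
          rw [if_pos (by omega)]
      _ = 0 := h

/-- **Tamagawa's identity in Satake form: the local Euler factor.** Let `v ≠ 0` be a `K`-fixed
vector on which `T_i` acts by `q^{i(n-i)/2} e_i(α)` (`i ≤ n`, `#α = n`: `α` is a Satake parameter
in the unitary normalisation of `IsSatakeParameter`) and `T(ϖ^m)` by `r_m`. Then the formal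
Hecke series is the reciprocal of the Euler polynomial at the twisted parameters
`q^{(n-1)/2} α`:
`(∑_m r_m X^m) · ∏_{a ∈ α} (1 - q^{(n-1)/2} a X) = 1` in `ℂ⟦X⟧`,
i.e. `∑_m r_m q^{-ms'} = ∏_a (1 - a q^{-s})⁻¹` formally at `s' = s + (n-1)/2` — the algebraic
content of the unramified computation `Z(1_{M_n(𝒪)}, s + (n-1)/2, ω°) = L(s, π)`
(Godement–Jacquet (1972), Lemma 6.10; Jacquet (1979), (1.4); Tamagawa (1963); Shimura (1971),
Thm. 3.21). [cite: ShimuraIATAF1971, Theorem 3.21] -/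
theorem mk_heckeDetEigenvalue_mul_eulerFactor_eq_one {V : Type*} [AddCommGroup V] [Module ℂ V]
    (ρ : Representation ℂ (GL (Fin n) F) V) [Finite 𝓀[F]] (hϖ : IsUniformizingElement ϖ)
    {v : V} (hv : v ∈ ρ.fixedPoints (glInt n F)) (hv0 : v ≠ 0) {α : Multiset ℂ}
    (hα : Multiset.card α = n) {r : ℕ → ℂ}
    (hτ : ∀ i ≤ n, heckeOperator ρ (glInt n F) (heckeDiag n (Units.mk0 ϖ hϖ.ne_zero) i) v =
      ((((Real.sqrt (Nat.card 𝓀[F]) : ℝ) : ℂ) ^ (i * (n - i))) * α.esymm i) • v)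
    (hr : ∀ m, heckeDetOperator ρ ϖ m v = r m • v) :
    PowerSeries.mk r *
      ((α.map fun a => (1 : Polynomial ℂ) -
        Polynomial.C (((Real.sqrt (Nat.card 𝓀[F]) : ℝ) : ℂ) ^ (n - 1) * a) *
          Polynomial.X).prod : Polynomial ℂ) = 1 := by
  rw [← heckePolynomial_eq_prod_one_sub (Nat.card 𝓀[F]) n α hα]
  exact mk_heckeDetEigenvalue_mul_heckePolynomial_eq_one ρ hϖ hv hv0
    (τ := fun i => (((Real.sqrt (Nat.card 𝓀[F]) : ℝ) : ℂ) ^ (i * (n - i))) * α.esymm i) hτ hr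

end Corollaries

end Literature.NumberTheory.Automorphic
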